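import Literature.MathematicalPhysics.QuantumFieldTheory.Balaban1983to89.Node00.Record13CarriersSep
import Literature.MathematicalPhysics.QuantumFieldTheory.Balaban1983to89.Node00.CarriersB8SubBP

/-!
# NODE 00 (YM-PLAN Track A) — THE CARRIER-PINNED STAGE-13 RECORDS, [B8″P]: the four-law [B8] pin ON THE P-CARRIER `Stage13Params.pinB8SubBP` over
# `withB8OfRecordSubBP` (`Node00/CarriersB8SubBP`) as ONE instance of dag-n10-d's generic `Stage13Params.rebindX` (`Node00/Record13Carriers`), its `rfl` transports in
# BOTH proviso vocabularies (`Provisos₁₃` v1.1, `Provisos₁₃Core` ∕ `Provisos₁₃Sep` v1.2), the `b8` leaf of the S-∕C-binding over the ONE-pin [B8″P] Stage-13 view BY `Iff.rfl`,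
# and the one-pin S-bound record AT THE SEPARATED-RANGE KEY `IsRecordOfRecord₁₃CSepSB8subBP` (SAME-datum companion in `IsRecordOfRecord₁₃CSep`; faces; slot form; rebind)
# — the P-carrier twin of n05-c g6's `Node00/Record13CarriersB8SubBH` (token map `SubBH ↦ SubBP`; sequel of it and of `Record13CarriersSep`; nothing edited in place)

NODE 00 RECORD MODULE (width seat `pub-ymgap-dag-n05-w1` g0, 2026-08-28, on the -d lane's word dag-n05-d g10 «type `Record13CarriersB8SubBP.lean`, I consume»).  APPEND-ONLY: a NEW
importing module; everything it reads is CONSUMED BY NAME (`Stage13Params.rebindX` ∕ `toStage5₁₃_rebindX` ∕ `rebindX_admissible_iff` ∕ `Provisos₁₃.rebindX` ∕ `datumOfRecord₁₃_rebindX`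
of dag-n10-d's `Node00/Record13Carriers`; `Provisos₁₃Core.rebindX` ∕ `Provisos₁₃Sep.rebindX` ∕ `datumOfRecord₁₃Core_rebindX` ∕ `datumOfRecord₁₃Sep_rebindX` ∕ `isRecordOfRecord₁₃CSep_rebindX_of_eq`
of dag-n10-d's `Node00/Record13CarriersSep`; def-T's `IsRecordOfRecord₁₃CSep` ∕ `exists_world_isRecordOfRecord₁₃CSep` ∕ `atWorld_of_isRecordOfRecord₁₃CSep` of `Node00/Record13` v1.2;
this seat's `withB8OfRecordSubBP` ∕ `B8LeafOfRecordSubBP` ∕ `C136_C162_famB8OfRecordSubBP` ∕ `b8LeafOfRecordSubBP_iff_classFree_and_P` ∕ `b8LeafOfRecordSubBP_of_b8LeafR` of `Node00/CarriersB8SubBP`).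
WHY.  dag-n05-d g10's kernel certificate `B8Prop3ShellModeVacuity.not_b8LeafOfRecordSubBH` (p585094) shows that the [B8″H] slot `B8LeafOfRecordSubBH θ λ` — hence the `b8` leaf of EVERY
record of n05-c g6's `Record13CarriersB8SubBH*` modules — is FALSE for every admissible `θ` (`θ.D ≥ 2`) and every residual layer (typed Prop. 3 reads (1.42) on a class
without crossing bonds).  The P-carrier (`B8LeafModelZd3P.zdGF3HP`, p588746) and the P-pin (`Node00/CarriersB8SubBP`, p592605) are in the tree; THIS FILE lifts the P-pin to
Stage 13 at the separated-range key exactly as n05-c g6 lifted the H-pin, so that N05's ∃-currency record can be re-homed on a slot that is NOT refuted and reads «the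
old pin's four class-free conjuncts ∧ Thm 2 ∕ Prop 3 ∕ Thm 4 ∕ Prop 7 ∕ Thm 8 AT THE P-MEMBERS» (`CarriersB8SubBP.b8LeafOfRecordSubBP_iff_classFree_and_P`) — the γ D-chain's targets.
The keyed images (`…SubBPCoP` ∕ `…SubBPCoPR` ∕ `…SubBPCoPH`) follow as separate modules.

WHAT IS DEFINED ∕ PROVED (kernel bookkeeping, 0 sorry).  §1 `Stage13Params.pinB8SubBP := θ.rebindX (·.withB8OfRecordSubBP θ₃ λ)` ∕ `_eq_rebindX` ∕ `_res_X` ∕ `_toStage3Params` ∕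
`_admissible_iff` ∕ `toStage5₁₃_pinB8SubBP`; provisos transport `Provisos₁₃.pinB8SubBP` ∕ `Provisos₁₃Core.pinB8SubBP` ∕ `Provisos₁₃Sep.pinB8SubBP`; UP-SIDE datums
`datumOfRecord₁₃_pinB8SubBP` ∕ `datumOfRecord₁₃Core_pinB8SubBP` ∕ `datumOfRecord₁₃Sep_pinB8SubBP` (`rfl`); the leaves `upOfRecord₅CS_toStage5₁₃_pinB8SubBP_b8_iff`
(`b8 ↔ B8LeafOfRecordSubBP`, `Iff.rfl`), `upOfRecord₅C_toStage5₁₃_pinB8SubBP_b8_iff` (typed), `upOfRecord₅CS_toStage5₁₃_pinB8SubBP_offB8` (`rfl` ×5).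
§2 **`IsRecordOfRecord₁₃CSepSB8subBP`** (the Sep-keyed ONE-pin S-bound record on the P-carrier), `exists_world_…` (world displayed), **`companion_of_…`** (same D ∕ C ∕ γ ∕ L
in `IsRecordOfRecord₁₃CSep`, witness `θ.pinB8SubBP λ`; typed ⇒ surviving), `leaf_b8_iff_of_…`, `leaf_b8_iff_classFree_and_P_of_…` (the READING at the record),
`b4_b5_b6_b7_of_…` (def-T's v1.2 transfer at the companion), `b8_b11_b10_main_iff_of_…`, `b8_main_of_…_of_slot`, `b8_main_of_…_of_fields`, `…_rebind_of_isRecordOfRecord₁₃CSep`,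
`exists_provisos_of_…`, `isRecordOfRecord₁₃CSep_pinB8SubBP_of_eq` (the C-bound presentation, instance of n10-d's generic face).
HONEST FRAMING: definitions + kernel bookkeeping; NO estimate; nothing of Bałaban's asserted; whether the P-slot CLOSES is the γ D-chain's ∕ the knits' business (dag-n05-d D3 ∕ D7 ∕ D9,
n05-w2 D4 ∕ D5, n05-w3 D6); the K1 v6 host is the planners'; N05 NOT discharged; counts unmoved; one finite T⁴ programme at fixed ε — NOT continuum ∕ ℝ⁴ ∕ infinite volume ∕
OS ∕ mass gap ∕ Clay.  No `sorry`, no `axiom`, no `opaque`, no `instance`, no `notation`.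
[Balaban1985RegularSpaces] = Commun. Math. Phys. **99** (1985) 75–102; [Balaban1989LargeFieldII] = Commun. Math. Phys. **122** (1989) 355–392; [Balaban1988Convergent] = Commun.
Math. Phys. **119** (1988) 243–285. -/

noncomputable section

namespace Literature.MathematicalPhysics.QuantumFieldTheory.Balaban1983to89.Node00

open T4Continuum AveragingRT T4FiniteEpsInhabited FlowStep FlowStepRuns DagBinding T4DatumAssembly
open B8LeafKnitRS (B8LeafRS)
open B8LeafModelZd3P (zdGF3P)
open B8IdxB8LawsB (IdxB8SubB famB8OfRecordSubB)
open scoped Matrix.Norms.L2Operator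

/-! ## §1. The [B8″P] pin at Stage 13 (one-liners over `rebindX`), in both proviso vocabularies -/

section PinB8SubBP13

variable (F : T4Family) (N : ℕ) [NeZero N]

/-- **The [B8″P] pin of Stage-13 parameters**: the carrier bundle re-bound, run by run, to the [B8] group of record READ AT THE P-MEMBERS (`withB8OfRecordSubBP`).
[cite: Balaban1985RegularSpaces, Thm 2 p.83, Thm 8 (1.146) p.101 (objects of record, Stage 3′(X.B8″H))] -/
def Stage13Params.pinB8SubBP (θ : Stage13Params F N) (lam : ResidB8 θ.toStage3Params) : Stage13Params F N :=
  θ.rebindX F N fun P => (θ.res.X P).withB8OfRecordSubBP θ.toStage3Params lam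

/-- Unfolding (`rfl`): the pin IS one generic `rebindX`. [cite: Balaban1988Convergent, p.244 (bookkeeping)] -/
theorem Stage13Params.pinB8SubBP_eq_rebindX (θ : Stage13Params F N) (lam : ResidB8 θ.toStage3Params) :
    θ.pinB8SubBP F N lam = θ.rebindX F N (fun P => (θ.res.X P).withB8OfRecordSubBP θ.toStage3Params lam) := rfl

/-- The [B8″P]-pinned carrier family at Stage 13, unfolded (`rfl`). [cite: Balaban1985RegularSpaces, Lemma 1 – Thm 8 pp.79–101 (bookkeeping)] -/
theorem Stage13Params.pinB8SubBP_res_X (θ : Stage13Params F N) (lam : ResidB8 θ.toStage3Params) (P : B12.RunParams) :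
    (θ.pinB8SubBP F N lam).res.X P = (θ.res.X P).withB8OfRecordSubBP θ.toStage3Params lam := rfl

/-- The [B8″P] pin keeps the Stage-3 dictionary (`rfl`). [cite: Balaban1985RegularSpaces, p.77 (bookkeeping)] -/
theorem Stage13Params.pinB8SubBP_toStage3Params (θ : Stage13Params F N) (lam : ResidB8 θ.toStage3Params) :
    (θ.pinB8SubBP F N lam).toStage3Params = θ.toStage3Params := rfl

/-- The [B8″P] pin keeps `L`, `γ`, `ε₂₉` (`rfl` ×3). [cite: Balaban1987RG1, (2.9) p.266 (bookkeeping)] -/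
theorem Stage13Params.pinB8SubBP_L_γ_ε₂₉ (θ : Stage13Params F N) (lam : ResidB8 θ.toStage3Params) :
    (θ.pinB8SubBP F N lam).L = θ.L ∧ (θ.pinB8SubBP F N lam).γ = θ.γ ∧ (θ.pinB8SubBP F N lam).ε₂₉ = θ.ε₂₉ := ⟨rfl, rfl, rfl⟩

/-- Admissibility is unchanged by the [B8″P] pin at Stage 13 (`Iff.rfl`, the generic face). [cite: Balaban1987RG1, (2.9) p.266 (bookkeeping)] -/
theorem Stage13Params.pinB8SubBP_admissible_iff (θ : Stage13Params F N) (lam : ResidB8 θ.toStage3Params) :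
    (θ.pinB8SubBP F N lam).Admissible F N ↔ θ.Admissible F N :=
  Stage13Params.rebindX_admissible_iff F N θ _

/-- The Stage-13 view of [B8″P]-pinned parameters IS the re-bound Stage-13 view (`rfl`, the generic face). [cite: Balaban1988Convergent, p.244 (bookkeeping)] -/
theorem Stage13Params.toStage5₁₃_pinB8SubBP (θ : Stage13Params F N) (lam : ResidB8 θ.toStage3Params) :
    (θ.pinB8SubBP F N lam).toStage5₁₃ F N = (θ.toStage5₁₃ F N).rebindX F N (fun P => (θ.res.X P).withB8OfRecordSubBP θ.toStage3Params lam) :=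
  Stage13Params.toStage5₁₃_rebindX F N θ _

variable {F N} in
/-- The v1.1 Stage-13 provisos transport along the [B8″P] pin. [cite: Balaban1988Convergent, (2.23)–(2.42) pp.259–262 (bookkeeping)] -/
theorem Stage13Params.Provisos₁₃.pinB8SubBP {θ : Stage13Params F N} (h : θ.Provisos₁₃ F N) (lam : ResidB8 θ.toStage3Params) :
    (θ.pinB8SubBP F N lam).Provisos₁₃ F N :=
  h.rebindX _

variable {F N} in
/-- The v1.2 core provisos transport along the [B8″P] pin. [cite: Balaban1988Convergent, (2.18) p.257, (3.2)–(3.9) pp.265–266 (bookkeeping)] -/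
theorem Stage13Params.Provisos₁₃Core.pinB8SubBP {θ : Stage13Params F N} (h : θ.Provisos₁₃Core F N) (lam : ResidB8 θ.toStage3Params) :
    (θ.pinB8SubBP F N lam).Provisos₁₃Core F N :=
  h.rebindX _

variable {F N} in
/-- The v1.2 separated-range provisos transport along the [B8″P] pin. [cite: Balaban1988Convergent, (2.23)–(2.42) pp.259–262; Balaban1985RegularSpaces, (1.3)–(1.6) p.77 (bookkeeping)] -/
theorem Stage13Params.Provisos₁₃Sep.pinB8SubBP {θ : Stage13Params F N} (h : θ.Provisos₁₃Sep F N) (lam : ResidB8 θ.toStage3Params) :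
    (θ.pinB8SubBP F N lam).Provisos₁₃Sep F N :=
  h.rebindX _

/-- UP-SIDE (v1.1): the Stage-13 datum of record is unchanged by the [B8″P] pin (`rfl`). [cite: Balaban1989LargeFieldII, Thm 1 + (0.1) pp.355–356 (bookkeeping)] -/
theorem datumOfRecord₁₃_pinB8SubBP (θ : Stage13Params F N) (h : θ.Provisos₁₃ F N) (lam : ResidB8 θ.toStage3Params) :
    datumOfRecord₁₃ F N (θ.pinB8SubBP F N lam) (h.pinB8SubBP lam) = datumOfRecord₁₃ F N θ h :=
  datumOfRecord₁₃_rebindX F N θ h _ (h.pinB8SubBP lam)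

/-- UP-SIDE (v1.2 core): the core datum is unchanged by the [B8″P] pin (`rfl`). [cite: Balaban1989LargeFieldII, Thm 1 + (0.1) pp.355–356 (bookkeeping)] -/
theorem datumOfRecord₁₃Core_pinB8SubBP (θ : Stage13Params F N) (h : θ.Provisos₁₃Core F N) (lam : ResidB8 θ.toStage3Params) :
    datumOfRecord₁₃Core F N (θ.pinB8SubBP F N lam) (h.pinB8SubBP lam) = datumOfRecord₁₃Core F N θ h :=
  datumOfRecord₁₃Core_rebindX F N θ h _ (h.pinB8SubBP lam)

/-- UP-SIDE (v1.2 separated range): the ⁗ datum of record is unchanged by the [B8″P] pin (`rfl`). [cite: Balaban1989LargeFieldII, Thm 1 + (0.1) pp.355–356 (bookkeeping)] -/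
theorem datumOfRecord₁₃Sep_pinB8SubBP (θ : Stage13Params F N) (h : θ.Provisos₁₃Sep F N) (lam : ResidB8 θ.toStage3Params) :
    datumOfRecord₁₃Sep F N (θ.pinB8SubBP F N lam) (h.pinB8SubBP lam) = datumOfRecord₁₃Sep F N θ h :=
  datumOfRecord₁₃Sep_rebindX F N θ h _ (h.pinB8SubBP lam)

/-- **THE `b8` LEAF OF THE S-BINDING OVER THE [B8″P]-PINNED STAGE-13 VIEW IS `B8LeafOfRecordSubBP`** (`Iff.rfl` through `toStage5₁₃_rebindX` and `carriers₃_withB8OfRecordSubBP`).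
[cite: Balaban1985RegularSpaces, Lemma 1 – Thm 8 pp.79–101, Thm 8 (1.146) p.101 (the leaf at the P-carrier objects of record)] -/
theorem upOfRecord₅CS_toStage5₁₃_pinB8SubBP_b8_iff (θ : Stage13Params F N) (lam : ResidB8 θ.toStage3Params) (P : B12.RunParams) :
    (upOfRecord₅CS F N ((θ.pinB8SubBP F N lam).toStage5₁₃ F N) P).b8 ↔ B8LeafOfRecordSubBP θ.toStage3Params lam :=
  Iff.rfl

/-- … and the C-binding's `b8` over it is the leaf AS TYPED at the P-group (`Iff.rfl`). [cite: Balaban1985RegularSpaces, Lemma 1 – Thm 8 pp.79–101 (bookkeeping)] -/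
theorem upOfRecord₅C_toStage5₁₃_pinB8SubBP_b8_iff (θ : Stage13Params F N) (lam : ResidB8 θ.toStage3Params) (P : B12.RunParams) :
    (upOfRecord₅C F N ((θ.pinB8SubBP F N lam).toStage5₁₃ F N) P).b8 ↔
      B8LeafR θ.D (θ.L : ℝ) lam.C₂ lam.B₁' lam.inp.B₀' lam.B₁ lam.B₂ lam.c₁ lam.inp lam.B₀β (B8Lemma1NonAbelian.blockPairNA θ.D θ.L θ.𝔸)
        (fun j : IdxB8SubB θ.toStage3Params => famB8OfRecordSubBP θ.toStage3Params lam.β lam.len j) lam.lan lam.cub (fun j => lam.toAxial j.1) :=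
  Iff.rfl

/-- The other leaves of the S-binding over the [B8″P]-pinned Stage-13 view are the C-binding's over the UNPINNED Stage-13 view (`rfl` ×5: the pin moves only the [B8] group,
the S-binding re-binds only `b8`). [cite: Balaban1989LargeFieldII, Thm 1 p.355 (bookkeeping)] -/
theorem upOfRecord₅CS_toStage5₁₃_pinB8SubBP_offB8 (θ : Stage13Params F N) (lam : ResidB8 θ.toStage3Params) (P : B12.RunParams) :
    (upOfRecord₅CS F N ((θ.pinB8SubBP F N lam).toStage5₁₃ F N) P).b9 = (upOfRecord₅C F N (θ.toStage5₁₃ F N) P).b9 ∧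
    (upOfRecord₅CS F N ((θ.pinB8SubBP F N lam).toStage5₁₃ F N) P).b10 = (upOfRecord₅C F N (θ.toStage5₁₃ F N) P).b10 ∧
    (upOfRecord₅CS F N ((θ.pinB8SubBP F N lam).toStage5₁₃ F N) P).b11 = (upOfRecord₅C F N (θ.toStage5₁₃ F N) P).b11 ∧
    (upOfRecord₅CS F N ((θ.pinB8SubBP F N lam).toStage5₁₃ F N) P).b12 = (upOfRecord₅C F N (θ.toStage5₁₃ F N) P).b12 ∧
    (upOfRecord₅CS F N ((θ.pinB8SubBP F N lam).toStage5₁₃ F N) P).rBasicStep = (upOfRecord₅C F N (θ.toStage5₁₃ F N) P).rBasicStep :=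
  ⟨rfl, rfl, rfl, rfl, rfl⟩

/-- **The C-bound presentation at the ⁗ key** (instance of dag-n10-d's `isRecordOfRecord₁₃CSep_rebindX_of_eq`): a world with def-T's pointed clauses whose upstream blocks
are the C-binding over the [B8″P]-PINNED Stage-13 view IS a v1.2 ₁₃C record at `datumOfRecord₁₃Sep θ h`. [cite: Balaban1989LargeFieldII, Thm 1 + (0.1) pp.355–356 (bookkeeping)] -/
theorem isRecordOfRecord₁₃CSep_pinB8SubBP_of_eq (θ : Stage13Params F N) (h : θ.Provisos₁₃Sep F N) (hθ : θ.Admissible F N) (lam : ResidB8 θ.toStage3Params)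
    (w : WorldP) (hC : w.C = (datumOfRecord₁₃Sep F N θ h).C) (hγ : 0 < w.γ ∧ w.γ ≤ θ.γ) (hL : w.L = (θ.L : ℝ))
    (hup : ∀ P, w.up P = upOfRecord₅C F N ((θ.pinB8SubBP F N lam).toStage5₁₃ F N) P) :
    IsRecordOfRecord₁₃CSep F N (datumOfRecord₁₃Sep F N θ h) w :=
  isRecordOfRecord₁₃CSep_rebindX_of_eq F N θ h hθ _ w hC hγ hL hup

end PinB8SubBP13

/-! ## §2. The ONE-pin S-bound Stage-13 record with [B8″P] AT THE SEPARATED-RANGE KEY; companion in `₁₃CSep`; faces; the reading; rebind -/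

section Record13SepB8subBP

variable (F : T4Family) (N : ℕ) [NeZero N]

/-- **«(D, w) is the record, Stage 13 (separated range), [B8] group pinned over the four-law sub-index ON THE P-CARRIER, `b8` surviving»**: def-T's
`IsRecordOfRecord₁₃CSep` VERBATIM except that the world is bound by the S-binding over the [B8″P]-PINNED Stage-13 view, for SOME residual [B8] layer `lam`.
[cite: Balaban1985RegularSpaces, Lemma 1 – Thm 8 pp.79–101, Thm 8 (1.146) p.101, (1.12) p.78; Balaban1989LargeFieldII, Thm 1 + (0.1) pp.355–356 (objects of record)] -/
def IsRecordOfRecord₁₃CSepSB8subBP (D : FiniteEpsData F (SU N)) (w : WorldP) : Prop :=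
  ∃ (θ : Stage13Params F N) (h : θ.Provisos₁₃Sep F N) (lam : ResidB8 θ.toStage3Params),
    θ.Admissible F N ∧ D = datumOfRecord₁₃Sep F N θ h ∧ w.C = D.C ∧ (0 < w.γ ∧ w.γ ≤ θ.γ) ∧ w.L = (θ.L : ℝ) ∧
      ∀ P : B12.RunParams, w.up P = upOfRecord₅CS F N ((θ.pinB8SubBP F N lam).toStage5₁₃ F N) P

/-- Inhabitation is Stage 13's exactly (the residual [B8] type is inhabited, `nonempty_residB8`): every admissible separated-range parameter presents a record of this module
at its own datum, ANY residual layer `lam`, any window. [cite: Balaban1989LargeFieldII, Thm 1 + (0.1) pp.355–356 (bookkeeping)] -/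
theorem exists_world_isRecordOfRecord₁₃CSepSB8subBP (θ : Stage13Params F N) (h : θ.Provisos₁₃Sep F N) (hθ : θ.Admissible F N) (lam : ResidB8 θ.toStage3Params)
    {γw : ℝ} (hγw : 0 < γw ∧ γw ≤ θ.γ) :
    ∃ w : WorldP, IsRecordOfRecord₁₃CSepSB8subBP F N (datumOfRecord₁₃Sep F N θ h) w ∧ w.γ = γw ∧
      ∀ P : B12.RunParams, w.up P = upOfRecord₅CS F N ((θ.pinB8SubBP F N lam).toStage5₁₃ F N) P := by
  obtain ⟨w₀, -, -⟩ := exists_world_isRecordOfRecord₁₃CSep F N θ h hθ hγw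
  exact ⟨{ w₀ with
      C := (datumOfRecord₁₃Sep F N θ h).C, γ := γw, L := (θ.L : ℝ), one_lt_L := by exact_mod_cast θ.hL.2,
      up := fun P => upOfRecord₅CS F N ((θ.pinB8SubBP F N lam).toStage5₁₃ F N) P },
    ⟨θ, h, lam, hθ, rfl, rfl, hγw, rfl, fun _ => rfl⟩, rfl, fun _ => rfl⟩

variable {F N}
variable {D : FiniteEpsData F (SU N)} {w : WorldP}

/-- **THE SAME-DATUM COMPANION IN `IsRecordOfRecord₁₃CSep`** (witness `θ.pinB8SubBP lam` under the C-binding): same `D`, `C`, window, `L`; leaves agree off `b8`; companion's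
`b8` (typed, over the P-sub-family) ⇒ record's `b8` (surviving) under the carrier law (1.36) ⊂ (1.62) — never conversely.
[cite: Balaban1985RegularSpaces, Thm 8 p.101 (surviving vs typed); Balaban1989LargeFieldII, Thm 1 + (0.1) pp.355–356 (bookkeeping)] -/
theorem companion_of_isRecordOfRecord₁₃CSepSB8subBP (h : IsRecordOfRecord₁₃CSepSB8subBP F N D w) :
    ∃ w' : WorldP, IsRecordOfRecord₁₃CSep F N D w' ∧ w'.C = w.C ∧ w'.γ = w.γ ∧ w'.L = w.L ∧
      (∀ P : B12.RunParams, leavesP w P = { leavesP w' P with b8 := (leavesP w P).b8 }) ∧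
      ∀ P : B12.RunParams, (leavesP w' P).b8 → (leavesP w P).b8 := by
  obtain ⟨θ, hP, lam, hθ, hD, hC, hγ, hL, hup⟩ := h
  have hup' : ∀ P, w.up P = (upOfRecord₅C F N ((θ.pinB8SubBP F N lam).toStage5₁₃ F N) P).withB8 (leavesP w P).b8 := fun P => by
    show w.up P = (upOfRecord₅C F N _ P).withB8 (w.up P).b8
    rw [hup P]
    rfl
  refine ⟨{ w with up := fun P => upOfRecord₅C F N ((θ.pinB8SubBP F N lam).toStage5₁₃ F N) P },
    ⟨θ.pinB8SubBP F N lam, hP.pinB8SubBP lam, (Stage13Params.pinB8SubBP_admissible_iff F N _ _).2 hθ, ?_, hC, hγ, hL, fun P => rfl⟩, rfl, rfl, rfl,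
      leavesP_eq_of_up_withB8 hup', fun P h8 => ?_⟩
  · rw [datumOfRecord₁₃Sep_pinB8SubBP F N θ hP lam]; exact hD
  · have h8' := (upOfRecord₅C_toStage5₁₃_pinB8SubBP_b8_iff F N θ lam P).1 h8
    show (w.up P).b8
    rw [hup P]
    exact (upOfRecord₅CS_toStage5₁₃_pinB8SubBP_b8_iff F N θ lam P).2 (b8LeafOfRecordSubBP_of_b8LeafR lam h8')

/-- The `b8` leaf at a record of this module, for ONE parameter package: it IS the P-slot. [cite: Balaban1985RegularSpaces, Lemma 1 – Thm 8 pp.79–101 (bookkeeping)] -/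
theorem leaf_b8_iff_of_isRecordOfRecord₁₃CSepSB8subBP (h : IsRecordOfRecord₁₃CSepSB8subBP F N D w) :
    ∃ (θ : Stage13Params F N) (lam : ResidB8 θ.toStage3Params), θ.Admissible F N ∧ w.L = (θ.L : ℝ) ∧
      ∀ P : B12.RunParams, (leavesP w P).b8 ↔ B8LeafOfRecordSubBP θ.toStage3Params lam := by
  obtain ⟨θ, -, lam, hθ, -, -, -, hL, hup⟩ := h
  refine ⟨θ, lam, hθ, hL, fun P => ?_⟩
  show (w.up P).b8 ↔ _
  rw [hup P]
  exact upOfRecord₅CS_toStage5₁₃_pinB8SubBP_b8_iff F N θ lam P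

/-- **THE READING AT THE RECORD**: at a record of this module the `b8` leaf is, for its presenting package, «the old pin's FOUR class-free conjuncts (Lemma 1, Prop 5 ∃ ∕ !, Prop 6 —
letter for letter the knits' conclusions) ∧ Thm 2 ∕ Prop 3 ∕ Thm 4 on `zdGF3P … ∘ (·.1.1)` ∧ Prop 7 ∕ Thm 8 surviving at γ = 1 AT THE P-MEMBERS» (`CarriersB8SubBP.b8LeafOfRecordSubBP_iff_classFree_and_P`).
[cite: Balaban1985RegularSpaces, Lemma 1 p.79, Thm 2 p.83, Prop. 3 p.87, Thm 4 p.88, Prop. 5 p.94, Prop. 6 p.99, Prop. 7 p.100, Thm 8 (1.146) p.101] -/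
theorem leaf_b8_iff_classFree_and_P_of_isRecordOfRecord₁₃CSepSB8subBP (h : IsRecordOfRecord₁₃CSepSB8subBP F N D w) :
    ∃ (θ : Stage13Params F N) (lam : ResidB8 θ.toStage3Params), θ.Admissible F N ∧ w.L = (θ.L : ℝ) ∧
      ∀ P : B12.RunParams, (leavesP w P).b8 ↔
        (B8.Lemma1Printed θ.D (B8Lemma1NonAbelian.blockPairNA θ.D θ.L θ.𝔸) ∧
          B8.Prop5Exists lam.inp.B₀' lam.B₁ lam.lan ∧ B8.Prop5Unique lam.lan ∧ B8.Prop6Printed θ.D (θ.L : ℝ) lam.B₁ lam.c₁ lam.cub) ∧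
        (B8.Thm2Printed (fun j : IdxB8SubB θ.toStage3Params => (zdGF3P θ.𝔸 θ.L lam.β lam.len j.1.1).toGFData) ∧
          B8.Prop3Printed θ.D (θ.L : ℝ) lam.C₂ lam.inp lam.B₀β
            (fun j : IdxB8SubB θ.toStage3Params => (zdGF3P θ.𝔸 θ.L lam.β lam.len j.1.1).toGFData2) ∧
          B8.Thm4Printed lam.B₁' (fun j : IdxB8SubB θ.toStage3Params => (zdGF3P θ.𝔸 θ.L lam.β lam.len j.1.1).toGFData) ∧
          B8SectGH.Prop7PrintedR (fun j : IdxB8SubB θ.toStage3Params => famB8OfRecordSubBP θ.toStage3Params lam.β lam.len j) (fun j => lam.toAxial j.1) ∧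
          B8Thm8Surviving.Thm8SurvivingAt 1 lam.B₁ lam.B₂ (fun j : IdxB8SubB θ.toStage3Params => famB8OfRecordSubBP θ.toStage3Params lam.β lam.len j)) := by
  obtain ⟨θ, lam, hθ, hL, hiff⟩ := leaf_b8_iff_of_isRecordOfRecord₁₃CSepSB8subBP h
  exact ⟨θ, lam, hθ, hL, fun P => (hiff P).trans (b8LeafOfRecordSubBP_iff_classFree_and_P lam)⟩

/-- A record of this module IS (through its companion) a separated-range Stage-13 record of the same datum at a world with the same `C ∕ γ ∕ L`.
[cite: Balaban1989LargeFieldII, Thm 1 + (0.1) pp.355–356 (bookkeeping)] -/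
theorem exists_isRecordOfRecord₁₃CSep_of_isRecordOfRecord₁₃CSepSB8subBP (h : IsRecordOfRecord₁₃CSepSB8subBP F N D w) :
    ∃ w' : WorldP, IsRecordOfRecord₁₃CSep F N D w' ∧ w'.C = w.C ∧ w'.γ = w.γ ∧ w'.L = w.L := by
  obtain ⟨w', hw', hC, hγ, hL, -, -⟩ := companion_of_isRecordOfRecord₁₃CSepSB8subBP h
  exact ⟨w', hw', hC, hγ, hL⟩

/-- The in-edges `b4 b5 b6 b7` are THEOREMS at a record of this module (via the companion and def-T's v1.2 transfer `atWorld_of_isRecordOfRecord₁₃CSep`).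
[cite: Balaban1983RegularityDecay, Thm p.573; Balaban1984PropagatorsI, Props. 1.1–1.2 pp.33–36; Balaban1984PropagatorsII, pp.223–250; Balaban1985Averaging, Props. 1–10 pp.26–50 (bookkeeping)] -/
theorem b4_b5_b6_b7_of_isRecordOfRecord₁₃CSepSB8subBP (h : IsRecordOfRecord₁₃CSepSB8subBP F N D w) (P : B12.RunParams) :
    (leavesP w P).b4 ∧ (leavesP w P).b5 ∧ (leavesP w P).b6 ∧ (leavesP w P).b7 := by
  obtain ⟨w', hw', -, -, -, hleaves, -⟩ := companion_of_isRecordOfRecord₁₃CSepSB8subBP h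
  have h' : (leavesP w' P).b4 ∧ (leavesP w' P).b5 ∧ (leavesP w' P).b6 ∧ (leavesP w' P).b7 :=
    atWorld_of_isRecordOfRecord₁₃CSep (X := fun ℓ => ℓ.b4 ∧ ℓ.b5 ∧ ℓ.b6 ∧ ℓ.b7)
      (fun _ _ h5 P =>
        have h4 := b4_main_of_isRecordOfRecord₅C h5 P
        have hb5 := b5_main_of_isRecordOfRecord₅C h5 P h4
        ⟨h4, hb5, N03_at_record₅C h5 P h4 hb5, b7_main_of_isRecordOfRecord₅C h5 P hb5⟩) hw' P
  rw [hleaves P]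
  exact h'

/-- **N05 ∕ N07 ∕ N08 AT A RECORD OF THIS MODULE** (in-edges b4–b7 are theorems). [cite: Balaban1985RegularSpaces, Thm 2 p.83, Thm 8 p.101; Balaban1985Variational, Thm 1 p.279; Balaban1985UV3, Thm 1 p.257 (bookkeeping)] -/
theorem b8_b11_b10_main_iff_of_isRecordOfRecord₁₃CSepSB8subBP (h : IsRecordOfRecord₁₃CSepSB8subBP F N D w) (P : B12.RunParams) :
    (Dag.B8_main (leavesP w P) ↔ ((leavesP w P).b9 → (leavesP w P).b8)) ∧
    (Dag.B11_main (leavesP w P) ↔ ((leavesP w P).b8 → (leavesP w P).b9 → (leavesP w P).b11)) ∧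
    (Dag.B10_main (leavesP w P) ↔ ((leavesP w P).b8 → (leavesP w P).b9 → (leavesP w P).b11 → (leavesP w P).b10)) := by
  obtain ⟨-, h5, h6, h7⟩ := b4_b5_b6_b7_of_isRecordOfRecord₁₃CSepSB8subBP h P
  exact ⟨⟨fun hN h9 => hN h5 h6 h7 h9, fun hN _ _ _ => hN⟩, ⟨fun hN h8 h9 => hN h5 h6 h7 h8 h9, fun hN _ _ _ => hN⟩,
    ⟨fun hN h8 h9 h11 => hN h5 h6 h7 h8 h9 h11, fun hN _ _ _ => hN⟩⟩

/-- **N05 «SLOT» FORM at a record of this module**: a closer of the P-slot `B8LeafOfRecordSubBP` at every presenting package gives `Dag.B8_main` at every run.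
[cite: Balaban1985RegularSpaces, Lemma 1 – Thm 8 pp.79–101, Thm 8 (1.146) p.101 (the node's shape, bookkeeping)] -/
theorem b8_main_of_isRecordOfRecord₁₃CSepSB8subBP_of_slot (h : IsRecordOfRecord₁₃CSepSB8subBP F N D w)
    (hB : ∀ (θ : Stage13Params F N) (hP : θ.Provisos₁₃Sep F N) (lam : ResidB8 θ.toStage3Params), θ.Admissible F N → D = datumOfRecord₁₃Sep F N θ hP →
      (∀ P, w.up P = upOfRecord₅CS F N ((θ.pinB8SubBP F N lam).toStage5₁₃ F N) P) → B8LeafOfRecordSubBP θ.toStage3Params lam)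
    (P : B12.RunParams) : Dag.B8_main (leavesP w P) := by
  obtain ⟨h8iff, -, -⟩ := b8_b11_b10_main_iff_of_isRecordOfRecord₁₃CSepSB8subBP h P
  obtain ⟨θ, hP, lam, hθ, hD, -, -, -, hup⟩ := h
  refine h8iff.2 fun _ => ?_
  show (w.up P).b8
  rw [hup P]
  exact (upOfRecord₅CS_toStage5₁₃_pinB8SubBP_b8_iff F N θ lam P).2 (hB θ hP lam hθ hD hup)

/-- **N05 «SLOT» FORM, READ**: a supplier of the four class-free conjuncts and of Thm 2 ∕ Prop 3 ∕ Thm 4 ∕ Prop 7 ∕ Thm 8 AT THE P-MEMBERS, at every presenting package, gives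
`Dag.B8_main` at every run of a record of this module (the slot form through `b8LeafOfRecordSubBP_iff_classFree_and_P`). [cite: Balaban1985RegularSpaces, Lemma 1 – Thm 8 pp.79–101, Thm 8 (1.146) p.101] -/
theorem b8_main_of_isRecordOfRecord₁₃CSepSB8subBP_of_fields (h : IsRecordOfRecord₁₃CSepSB8subBP F N D w)
    (hB : ∀ (θ : Stage13Params F N) (hP : θ.Provisos₁₃Sep F N) (lam : ResidB8 θ.toStage3Params), θ.Admissible F N → D = datumOfRecord₁₃Sep F N θ hP →
      (∀ P, w.up P = upOfRecord₅CS F N ((θ.pinB8SubBP F N lam).toStage5₁₃ F N) P) →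
        (B8.Lemma1Printed θ.D (B8Lemma1NonAbelian.blockPairNA θ.D θ.L θ.𝔸) ∧
          B8.Prop5Exists lam.inp.B₀' lam.B₁ lam.lan ∧ B8.Prop5Unique lam.lan ∧ B8.Prop6Printed θ.D (θ.L : ℝ) lam.B₁ lam.c₁ lam.cub) ∧
        (B8.Thm2Printed (fun j : IdxB8SubB θ.toStage3Params => (zdGF3P θ.𝔸 θ.L lam.β lam.len j.1.1).toGFData) ∧
          B8.Prop3Printed θ.D (θ.L : ℝ) lam.C₂ lam.inp lam.B₀β
            (fun j : IdxB8SubB θ.toStage3Params => (zdGF3P θ.𝔸 θ.L lam.β lam.len j.1.1).toGFData2) ∧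
          B8.Thm4Printed lam.B₁' (fun j : IdxB8SubB θ.toStage3Params => (zdGF3P θ.𝔸 θ.L lam.β lam.len j.1.1).toGFData) ∧
          B8SectGH.Prop7PrintedR (fun j : IdxB8SubB θ.toStage3Params => famB8OfRecordSubBP θ.toStage3Params lam.β lam.len j) (fun j => lam.toAxial j.1) ∧
          B8Thm8Surviving.Thm8SurvivingAt 1 lam.B₁ lam.B₂ (fun j : IdxB8SubB θ.toStage3Params => famB8OfRecordSubBP θ.toStage3Params lam.β lam.len j)))
    (P : B12.RunParams) : Dag.B8_main (leavesP w P) :=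
  b8_main_of_isRecordOfRecord₁₃CSepSB8subBP_of_slot h (fun θ hP lam hθ hD hup => (b8LeafOfRecordSubBP_iff_classFree_and_P lam).2 (hB θ hP lam hθ hD hup)) P

/-- RE-BINDING a `₁₃CSep` record's world by the S-binding over the [B8″P]-pinned view gives a record of this module with the SAME datum — the ∃-currency entry point (the [B8]
layer `lam`, e.g. the cut layer `λ.cutSubB J lan c₁`, is CHOSEN here). [cite: Balaban1989LargeFieldII, Thm 1 p.355 (bookkeeping)] -/
theorem isRecordOfRecord₁₃CSepSB8subBP_rebind_of_isRecordOfRecord₁₃CSep (h : IsRecordOfRecord₁₃CSep F N D w) :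
    ∃ (θ : Stage13Params F N) (_ : θ.Provisos₁₃Sep F N), θ.Admissible F N ∧ (∀ P, w.up P = upOfRecord₅C F N (θ.toStage5₁₃ F N) P) ∧
      ∀ lam : ResidB8 θ.toStage3Params,
        IsRecordOfRecord₁₃CSepSB8subBP F N D { w with up := fun P => upOfRecord₅CS F N ((θ.pinB8SubBP F N lam).toStage5₁₃ F N) P } := by
  obtain ⟨θ, hP, hθ, hD, hC, hγ, hL, hup⟩ := h
  exact ⟨θ, hP, hθ, hup, fun lam => ⟨θ, hP, lam, hθ, hD, hC, hγ, hL, fun _ => rfl⟩⟩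

/-- Every record of this module sits at a v1.2 datum of record presented by admissible separated-range parameters (projection). [cite: Balaban1989LargeFieldII, Thm 1 + (0.1) pp.355–356 (bookkeeping)] -/
theorem exists_provisos_of_isRecordOfRecord₁₃CSepSB8subBP (h : IsRecordOfRecord₁₃CSepSB8subBP F N D w) :
    ∃ (θ : Stage13Params F N) (hP : θ.Provisos₁₃Sep F N), θ.Admissible F N ∧ D = datumOfRecord₁₃Sep F N θ hP := by
  obtain ⟨θ, hP, -, hθ, hD, -⟩ := h
  exact ⟨θ, hP, hθ, hD⟩

end Record13SepB8subBP

#print axioms companion_of_isRecordOfRecord₁₃CSepSB8subBP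
#print axioms b8_main_of_isRecordOfRecord₁₃CSepSB8subBP_of_fields

end Literature.MathematicalPhysics.QuantumFieldTheory.Balaban1983to89.Node00

end
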